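import Summits.RiemannHypothesis.RiemannHypothesis.Theorems.Splittings.LinearRayRh
import HarnessLib

/-!
# The derivative-free two-point certificate against the linear-factor ray (cell rh-split, dbn × neg, gen 2)

Part 2 of the RAW typing by seat rh-split-dbn-neg g2 (HOME/rh-split-dbn-neg/LinearRayTwoPointRawA.lean; part 1 =
`Theorems/Splittings/LinearRayRh.lean`). Content: Stage A — the derivative-free two-point certificate against the ray
(`not_linearRay_of_signChange`, mirror `…'`); Stage B — interval positivity of the forward average
`Q_a(x) := (∫ y in Ioi 0, deBruijnH 0 (x + y) * exp (−a y)).re` from three numbers by the ODE `G′ = aG − a²H_0`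
(`re_rayG_lower_bound`, `fwdAvg_pos_of_margin`); Stage C — the assembled and scale-free certificates
(`not_linearRay_certificate`, `exists_nonreal_zero_linearFactorH`, `not_linearRay_certificate_scaled`) = the typed
interface of the RH-FREE computational TARGET «LehmerWindowData» of the cell matrix (numerics NOT in kernel; the
Lehmer-window glue consuming the tree's high-window certificates is NOT in this file).
HONEST LABEL: SPLITTING SEARCH over kernel-typed RH-EQUIVALENCES; refuting the ray is RH-free bookkeeping (the ray is
RH-strengthening, part 1); nothing here bears on the truth of RH.
-/

set_option linter.dupNamespace false  -- the mandated namespace repeats `RiemannHypothesis`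

noncomputable section

namespace Summit.RiemannHypothesis.RiemannHypothesis.Theorems.Splittings.LinearRayTwoPoint

open Complex Filter Topology MeasureTheory Set
open Literature.NumberTheory.LFunctions Literature.Analysis.Complex
open Literature.Barriers.RiemannHypothesis (linearFactorH linearFactorH_eq_deBruijnHDiv_add_deriv)
open Summit.RiemannHypothesis.RiemannHypothesis.Theorems

/-! ## Stage A — the derivative-free two-point certificate -/

/-- **Two-point certificate.**  If `a > 0`, `0 ≤ x ≤ x'`, the forward average `Q_a` is positive on
`[x, x']`, and `H_0` changes sign from `+` at `x` to `−` at `x'`, then `linearFactorH a` has a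
non-real zero.  Proof: under the ray, Laguerre gives `(u'/u)' ≤ 0` where `u = a² Q_a > 0` on the
interval, and `u'/u = a − a² H_0/u`; so `H_0/u` is non-decreasing on `[x, x']`, contradicting
`H_0(x)/u(x) > 0 > H_0(x')/u(x')`. -/
theorem not_linearRay_of_signChange {a x x' : ℝ} (ha : 0 < a) (hx : 0 ≤ x) (hxx' : x ≤ x')
    (hQ : ∀ s ∈ Icc x x', 0 < (∫ y in Ioi (0 : ℝ), deBruijnH 0 ((s : ℂ) + y) * (Real.exp (-(a * y)) : ℂ)).re)
    (hHx : 0 < (deBruijnH 0 x).re) (hHx' : (deBruijnH 0 x').re < 0) : ¬ HasOnlyRealZeros (linearFactorH a) := by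
  intro hZ
  set u : ℝ → ℝ := fun t ↦ ((deriv (deBruijnHDiv fun u : ℝ => 1 + u ^ 2 / a ^ 2) t + (a : ℂ) * deBruijnHDiv (fun u : ℝ => 1 + u ^ 2 / a ^ 2) t)).re with hu
  set v : ℝ → ℝ := fun t ↦ (deriv (fun z : ℂ => deriv (deBruijnHDiv fun u : ℝ => 1 + u ^ 2 / a ^ 2) z + (a : ℂ) * deBruijnHDiv (fun u : ℝ => 1 + u ^ 2 / a ^ 2) z) t).re with hv
  set w : ℝ → ℝ := fun t ↦ (deriv (deriv (fun z : ℂ => deriv (deBruijnHDiv fun u : ℝ => 1 + u ^ 2 / a ^ 2) z + (a : ℂ) * deBruijnHDiv (fun u : ℝ => 1 + u ^ 2 / a ^ 2) z)) t).re with hw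
  have hu' : ∀ s : ℝ, HasDerivAt u (v s) s := fun s ↦ hasDerivAt_re_rayG a s
  have hv' : ∀ s : ℝ, HasDerivAt v (w s) s := fun s ↦ hasDerivAt_re_deriv_rayG a s
  have hLag : ∀ s : ℝ, u s * w s ≤ v s ^ 2 := fun s ↦ laguerre_rayG ha.ne' hZ s
  have hupos : ∀ s ∈ Icc x x', 0 < u s := fun s hs ↦ by
    simp only [hu]
    rw [re_rayG_eq_sq_mul_fwdAvg ha (hx.trans hs.1)]
    exact mul_pos (by positivity) (hQ s hs)
  have hvval : ∀ s : ℝ, v s = a * u s - a ^ 2 * (deBruijnH 0 s).re := fun s ↦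
    re_deriv_rayG ha.ne' s
  -- ψ := v / u is antitone on [x, x']
  set ψ : ℝ → ℝ := fun t ↦ v t / u t with hψ
  have hψ' : ∀ s ∈ Icc x x', HasDerivAt ψ ((w s * u s - v s * v s) / u s ^ 2) s := fun s hs ↦
    (hv' s).div (hu' s) (hupos s hs).ne'
  have hanti : AntitoneOn ψ (Icc x x') := by
    refine antitoneOn_of_deriv_nonpos (convex_Icc x x')
      (fun s hs ↦ (hψ' s hs).continuousAt.continuousWithinAt)
      (fun s hs ↦ (hψ' s (interior_subset hs)).differentiableAt.differentiableWithinAt)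
      fun s hs ↦ ?_
    rw [(hψ' s (interior_subset hs)).deriv]
    exact div_nonpos_of_nonpos_of_nonneg (by nlinarith [hLag s]) (sq_nonneg _)
  have hxm : x ∈ Icc x x' := ⟨le_rfl, hxx'⟩
  have hx'm : x' ∈ Icc x x' := ⟨hxx', le_rfl⟩
  have hmono : ψ x' ≤ ψ x := hanti hxm hx'm hxx'
  have hψval : ∀ s ∈ Icc x x', ψ s = a - a ^ 2 * ((deBruijnH 0 s).re / u s) := fun s hs ↦ by
    have hne : u s ≠ 0 := (hupos s hs).ne'
    simp only [hψ]
    rw [hvval s]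
    field_simp
  rw [hψval x hxm, hψval x' hx'm] at hmono
  have h1 : 0 < (deBruijnH 0 x).re / u x := div_pos hHx (hupos x hxm)
  have h2 : (deBruijnH 0 x').re / u x' < 0 := div_neg_of_neg_of_pos hHx' (hupos x' hx'm)
  have ha2 : 0 < a ^ 2 := by positivity
  nlinarith [mul_pos ha2 (sub_pos.2 (h2.trans h1))]

/-- Mirror form: `Q_a < 0` on `[x, x']` and `H_0` changes sign from `−` to `+`. -/
theorem not_linearRay_of_signChange' {a x x' : ℝ} (ha : 0 < a) (hx : 0 ≤ x) (hxx' : x ≤ x')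
    (hQ : ∀ s ∈ Icc x x', (∫ y in Ioi (0 : ℝ), deBruijnH 0 ((s : ℂ) + y) * (Real.exp (-(a * y)) : ℂ)).re < 0)
    (hHx : (deBruijnH 0 x).re < 0) (hHx' : 0 < (deBruijnH 0 x').re) : ¬ HasOnlyRealZeros (linearFactorH a) := by
  intro hZ
  set u : ℝ → ℝ := fun t ↦ ((deriv (deBruijnHDiv fun u : ℝ => 1 + u ^ 2 / a ^ 2) t + (a : ℂ) * deBruijnHDiv (fun u : ℝ => 1 + u ^ 2 / a ^ 2) t)).re with hu
  set v : ℝ → ℝ := fun t ↦ (deriv (fun z : ℂ => deriv (deBruijnHDiv fun u : ℝ => 1 + u ^ 2 / a ^ 2) z + (a : ℂ) * deBruijnHDiv (fun u : ℝ => 1 + u ^ 2 / a ^ 2) z) t).re with hv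
  set w : ℝ → ℝ := fun t ↦ (deriv (deriv (fun z : ℂ => deriv (deBruijnHDiv fun u : ℝ => 1 + u ^ 2 / a ^ 2) z + (a : ℂ) * deBruijnHDiv (fun u : ℝ => 1 + u ^ 2 / a ^ 2) z)) t).re with hw
  have hu' : ∀ s : ℝ, HasDerivAt u (v s) s := fun s ↦ hasDerivAt_re_rayG a s
  have hv' : ∀ s : ℝ, HasDerivAt v (w s) s := fun s ↦ hasDerivAt_re_deriv_rayG a s
  have hLag : ∀ s : ℝ, u s * w s ≤ v s ^ 2 := fun s ↦ laguerre_rayG ha.ne' hZ s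
  have huneg : ∀ s ∈ Icc x x', u s < 0 := fun s hs ↦ by
    simp only [hu]
    rw [re_rayG_eq_sq_mul_fwdAvg ha (hx.trans hs.1)]
    exact mul_neg_of_pos_of_neg (by positivity) (hQ s hs)
  have hvval : ∀ s : ℝ, v s = a * u s - a ^ 2 * (deBruijnH 0 s).re := fun s ↦
    re_deriv_rayG ha.ne' s
  set ψ : ℝ → ℝ := fun t ↦ v t / u t with hψ
  have hψ' : ∀ s ∈ Icc x x', HasDerivAt ψ ((w s * u s - v s * v s) / u s ^ 2) s := fun s hs ↦
    (hv' s).div (hu' s) (huneg s hs).ne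
  have hanti : AntitoneOn ψ (Icc x x') := by
    refine antitoneOn_of_deriv_nonpos (convex_Icc x x')
      (fun s hs ↦ (hψ' s hs).continuousAt.continuousWithinAt)
      (fun s hs ↦ (hψ' s (interior_subset hs)).differentiableAt.differentiableWithinAt)
      fun s hs ↦ ?_
    rw [(hψ' s (interior_subset hs)).deriv]
    -- u < 0: from u·w ≤ v², w·u − v·v ≤ 0 still holds (it is the same quantity)
    exact div_nonpos_of_nonpos_of_nonneg (by nlinarith [hLag s]) (sq_nonneg _)
  have hxm : x ∈ Icc x x' := ⟨le_rfl, hxx'⟩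
  have hx'm : x' ∈ Icc x x' := ⟨hxx', le_rfl⟩
  have hmono : ψ x' ≤ ψ x := hanti hxm hx'm hxx'
  have hψval : ∀ s ∈ Icc x x', ψ s = a - a ^ 2 * ((deBruijnH 0 s).re / u s) := fun s hs ↦ by
    have hne : u s ≠ 0 := (huneg s hs).ne
    simp only [hψ]
    rw [hvval s]
    field_simp
  rw [hψval x hxm, hψval x' hx'm] at hmono
  have h1 : 0 < (deBruijnH 0 x).re / u x := div_pos_of_neg_of_neg hHx (huneg x hxm)
  have h2 : (deBruijnH 0 x').re / u x' < 0 := div_neg_of_pos_of_neg hHx' (huneg x' hx'm)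
  have ha2 : 0 < a ^ 2 := by positivity
  nlinarith [mul_pos ha2 (sub_pos.2 (h2.trans h1))]

/-! ## Stage B — interval positivity of `Q_a` from three numbers (no quadrature) -/

/-- **Backward propagation.**  If `−M ≤ Re H_0` on `[x, x']` (`M ≥ 0`), then for every
`s ∈ [x, x']`:  `u(s) ≥ e^{−a(x'−s)} u(x') − a² M (x' − s)`, where `u = Re G_a`.  Proof:
`φ(r) := e^{−a r} u(r) − a² M e^{−a s} r` has `φ' = −a² e^{−ar} Re H_0(r) − a² M e^{−as} ≤ 0` on
`[s, x']` (the ODE `u' = a u − a² Re H_0`), so `φ(x') ≤ φ(s)`. -/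
theorem re_rayG_lower_bound {a x x' M : ℝ} (ha : 0 < a) (hM0 : 0 ≤ M)
    (hM : ∀ r ∈ Icc x x', -M ≤ (deBruijnH 0 r).re) {s : ℝ} (hs : s ∈ Icc x x') :
    Real.exp (-(a * (x' - s))) * ((deriv (deBruijnHDiv fun u : ℝ => 1 + u ^ 2 / a ^ 2) x' + (a : ℂ) * deBruijnHDiv (fun u : ℝ => 1 + u ^ 2 / a ^ 2) x')).re - a ^ 2 * M * (x' - s) ≤ ((deriv (deBruijnHDiv fun u : ℝ => 1 + u ^ 2 / a ^ 2) s + (a : ℂ) * deBruijnHDiv (fun u : ℝ => 1 + u ^ 2 / a ^ 2) s)).re := by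
  set φ : ℝ → ℝ := fun r ↦ Real.exp (-(a * r)) * ((deriv (deBruijnHDiv fun u : ℝ => 1 + u ^ 2 / a ^ 2) r + (a : ℂ) * deBruijnHDiv (fun u : ℝ => 1 + u ^ 2 / a ^ 2) r)).re
    - a ^ 2 * M * Real.exp (-(a * s)) * r with hφ
  have hφ' : ∀ r, HasDerivAt φ (-(a ^ 2) * Real.exp (-(a * r)) * (deBruijnH 0 r).re
      - a ^ 2 * M * Real.exp (-(a * s))) r := by
    intro r
    have h1 : HasDerivAt (fun r : ℝ ↦ -(a * r)) (-a) r := by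
      simpa [neg_mul] using (hasDerivAt_id' r).const_mul (-a)
    have he : HasDerivAt (fun r : ℝ ↦ Real.exp (-(a * r))) (Real.exp (-(a * r)) * (-a)) r :=
      h1.exp
    have h2 := (he.mul (hasDerivAt_re_rayG a r)).sub
      ((hasDerivAt_id' r).const_mul (a ^ 2 * M * Real.exp (-(a * s))))
    refine h2.congr_deriv ?_
    rw [re_deriv_rayG ha.ne' r]
    ring
  have hanti : AntitoneOn φ (Icc s x') := by
    refine antitoneOn_of_deriv_nonpos (convex_Icc s x')
      (fun r _ ↦ (hφ' r).continuousAt.continuousWithinAt)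
      (fun r _ ↦ (hφ' r).differentiableAt.differentiableWithinAt) fun r hr ↦ ?_
    rw [(hφ' r).deriv]
    have hr' : r ∈ Icc s x' := interior_subset hr
    have hrx : r ∈ Icc x x' := ⟨hs.1.trans hr'.1, hr'.2⟩
    have hexp : Real.exp (-(a * r)) ≤ Real.exp (-(a * s)) :=
      Real.exp_le_exp.2 (by nlinarith [hr'.1, ha.le])
    have hHr : -M ≤ (deBruijnH 0 r).re := hM r hrx
    have hE : 0 ≤ Real.exp (-(a * r)) := (Real.exp_pos _).le
    have ha2 : 0 ≤ a ^ 2 := sq_nonneg a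
    -- −a² e^{−ar} H(r) ≤ a² e^{−ar} M ≤ a² e^{−as} M
    have h1 : -(a ^ 2) * Real.exp (-(a * r)) * (deBruijnH 0 r).re
        ≤ a ^ 2 * Real.exp (-(a * r)) * M := by
      have hk : 0 ≤ a ^ 2 * Real.exp (-(a * r)) * ((deBruijnH 0 r).re + M) :=
        mul_nonneg (mul_nonneg ha2 hE) (by linarith)
      linarith [hk, show -(a ^ 2) * Real.exp (-(a * r)) * (deBruijnH 0 r).re
        = a ^ 2 * Real.exp (-(a * r)) * M - a ^ 2 * Real.exp (-(a * r)) * ((deBruijnH 0 r).re + M)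
        by ring]
    have h2 : a ^ 2 * Real.exp (-(a * r)) * M ≤ a ^ 2 * Real.exp (-(a * s)) * M := by
      have hk : 0 ≤ a ^ 2 * M * (Real.exp (-(a * s)) - Real.exp (-(a * r))) :=
        mul_nonneg (mul_nonneg ha2 hM0) (by linarith)
      linarith [hk, show a ^ 2 * Real.exp (-(a * s)) * M
        = a ^ 2 * Real.exp (-(a * r)) * M + a ^ 2 * M * (Real.exp (-(a * s)) - Real.exp (-(a * r)))
        by ring]
    linarith
  have hsx' : s ≤ x' := hs.2
  have hle : φ x' ≤ φ s := hanti ⟨le_rfl, hsx'⟩ ⟨hsx', le_rfl⟩ hsx'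
  simp only [hφ] at hle
  have hes : 0 < Real.exp (-(a * s)) := Real.exp_pos _
  have hprod : Real.exp (-(a * (x' - s))) * Real.exp (-(a * s)) = Real.exp (-(a * x')) := by
    rw [← Real.exp_add]; ring_nf
  have key : Real.exp (-(a * s)) * (Real.exp (-(a * (x' - s))) * ((deriv (deBruijnHDiv fun u : ℝ => 1 + u ^ 2 / a ^ 2) x' + (a : ℂ) * deBruijnHDiv (fun u : ℝ => 1 + u ^ 2 / a ^ 2) x')).re
      - a ^ 2 * M * (x' - s)) ≤ Real.exp (-(a * s)) * ((deriv (deBruijnHDiv fun u : ℝ => 1 + u ^ 2 / a ^ 2) s + (a : ℂ) * deBruijnHDiv (fun u : ℝ => 1 + u ^ 2 / a ^ 2) s)).re := by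
    have expand : Real.exp (-(a * s)) * (Real.exp (-(a * (x' - s))) * ((deriv (deBruijnHDiv fun u : ℝ => 1 + u ^ 2 / a ^ 2) x' + (a : ℂ) * deBruijnHDiv (fun u : ℝ => 1 + u ^ 2 / a ^ 2) x')).re
        - a ^ 2 * M * (x' - s))
        = Real.exp (-(a * x')) * ((deriv (deBruijnHDiv fun u : ℝ => 1 + u ^ 2 / a ^ 2) x' + (a : ℂ) * deBruijnHDiv (fun u : ℝ => 1 + u ^ 2 / a ^ 2) x')).re - a ^ 2 * M * Real.exp (-(a * s)) * x'
          + a ^ 2 * M * Real.exp (-(a * s)) * s := by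
      rw [← hprod]; ring
    rw [expand]
    linarith [hle]
  exact le_of_mul_le_mul_left key hes

/-- **Interval positivity from three numbers.**  `a > 0`, `0 ≤ x ≤ x'`, `q₀ ≤ Q_a(x')`,
`−M ≤ Re H_0` on `[x, x']` with `M ≥ 0`, and the margin `(x' − x)·M < e^{−a(x'−x)}·q₀`
imply `Q_a > 0` on `[x, x']`. -/
theorem fwdAvg_pos_of_margin {a x x' q₀ M : ℝ} (ha : 0 < a) (hx : 0 ≤ x) (hxx' : x ≤ x')
    (hq : q₀ ≤ (∫ y in Ioi (0 : ℝ), deBruijnH 0 ((x' : ℂ) + y) * (Real.exp (-(a * y)) : ℂ)).re) (hM0 : 0 ≤ M) (hM : ∀ r ∈ Icc x x', -M ≤ (deBruijnH 0 r).re)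
    (hmargin : (x' - x) * M < Real.exp (-(a * (x' - x))) * q₀) :
    ∀ s ∈ Icc x x', 0 < (∫ y in Ioi (0 : ℝ), deBruijnH 0 ((s : ℂ) + y) * (Real.exp (-(a * y)) : ℂ)).re := by
  intro s hs
  have hs0 : 0 ≤ s := hx.trans hs.1
  have hlow := re_rayG_lower_bound ha hM0 hM hs
  rw [re_rayG_eq_sq_mul_fwdAvg ha (hx.trans hxx'), re_rayG_eq_sq_mul_fwdAvg ha hs0] at hlow
  have ha2 : 0 < a ^ 2 := by positivity
  have hq0 : 0 < q₀ := by
    have h0 : 0 ≤ (x' - x) * M := mul_nonneg (sub_nonneg.2 hxx') hM0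
    have h1 : 0 < Real.exp (-(a * (x' - x))) * q₀ := lt_of_le_of_lt h0 hmargin
    by_contra hq'
    push Not at hq'
    have : Real.exp (-(a * (x' - x))) * q₀ ≤ 0 :=
      mul_nonpos_iff.2 (Or.inl ⟨(Real.exp_pos _).le, hq'⟩)
    linarith
  -- monotonicity in s of the margin: (x' − s) ≤ (x' − x), e^{−a(x'−s)} ≥ e^{−a(x'−x)}
  have hexp : Real.exp (-(a * (x' - x))) ≤ Real.exp (-(a * (x' - s))) :=
    Real.exp_le_exp.2 (by nlinarith [hs.1, ha.le])
  have hlen : (x' - s) * M ≤ (x' - x) * M := mul_le_mul_of_nonneg_right (by linarith [hs.1]) hM0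
  have hpos : 0 < Real.exp (-(a * (x' - s))) * q₀ - (x' - s) * M := by
    have : Real.exp (-(a * (x' - x))) * q₀ ≤ Real.exp (-(a * (x' - s))) * q₀ :=
      mul_le_mul_of_nonneg_right hexp hq0.le
    linarith
  have hE : 0 ≤ Real.exp (-(a * (x' - s))) := (Real.exp_pos _).le
  have hchain : Real.exp (-(a * (x' - s))) * (a ^ 2 * q₀)
      ≤ Real.exp (-(a * (x' - s))) * (a ^ 2 * (∫ y in Ioi (0 : ℝ), deBruijnH 0 ((x' : ℂ) + y) * (Real.exp (-(a * y)) : ℂ)).re) :=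
    mul_le_mul_of_nonneg_left (mul_le_mul_of_nonneg_left hq ha2.le) hE
  have hmul : 0 < a ^ 2 * (∫ y in Ioi (0 : ℝ), deBruijnH 0 ((s : ℂ) + y) * (Real.exp (-(a * y)) : ℂ)).re := by
    have : a ^ 2 * (Real.exp (-(a * (x' - s))) * q₀ - (x' - s) * M)
        = Real.exp (-(a * (x' - s))) * (a ^ 2 * q₀) - a ^ 2 * M * (x' - s) := by ring
    have h3 : 0 < a ^ 2 * (Real.exp (-(a * (x' - s))) * q₀ - (x' - s) * M) := mul_pos ha2 hpos
    linarith
  by_contra hneg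
  push Not at hneg
  have : a ^ 2 * (∫ y in Ioi (0 : ℝ), deBruijnH 0 ((s : ℂ) + y) * (Real.exp (-(a * y)) : ℂ)).re ≤ 0 := mul_nonpos_iff.2 (Or.inl ⟨ha2.le, hneg⟩)
  linarith

/-! ## Stage C interface — the numerical TARGET, typed -/

/-- **Certificate (typed numerical target).**  Four facts about `H_0` and its forward average near
ONE `+ → −` sign change of `H_0` on `[0, ∞)` refute the linear ray at slope `a > 0`:
`0 < Re H_0(x)`, `Re H_0(x') < 0`, `q₀ ≤ Q_a(x')`, `−M ≤ Re H_0` on `[x, x']`, and the margin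
`(x' − x)·M < e^{−a(x'−x)}·q₀`.  At Lehmer's pair (`x' = 2·7005.08 = 14010.16`, where the tree
already certifies `Re H_0(x') < 0 < Q_a(x')` for `a ∈ [3/2, 32]`,
`UniversalFactor.OneSidedAverageSignTest.stub_highWindow`) design numerics give the margin for
`a ≲ 16` with `x = x' − 0.06` and `M` = the dip depth. -/
theorem not_linearRay_certificate {a x x' q₀ M : ℝ} (ha : 0 < a) (hx : 0 ≤ x) (hxx' : x ≤ x')
    (hHx : 0 < (deBruijnH 0 x).re) (hHx' : (deBruijnH 0 x').re < 0)
    (hq : q₀ ≤ (∫ y in Ioi (0 : ℝ), deBruijnH 0 ((x' : ℂ) + y) * (Real.exp (-(a * y)) : ℂ)).re) (hM0 : 0 ≤ M) (hM : ∀ r ∈ Icc x x', -M ≤ (deBruijnH 0 r).re)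
    (hmargin : (x' - x) * M < Real.exp (-(a * (x' - x))) * q₀) : ¬ HasOnlyRealZeros (linearFactorH a) :=
  not_linearRay_of_signChange ha hx hxx' (fwdAvg_pos_of_margin ha hx hxx' hq hM0 hM hmargin) hHx hHx'

/-- The same certificate stated against the barrier file's constant: a non-real zero of
`linearFactorH a` exists. -/
theorem exists_nonreal_zero_linearFactorH {a x x' q₀ M : ℝ} (ha : 0 < a) (hx : 0 ≤ x)
    (hxx' : x ≤ x') (hHx : 0 < (deBruijnH 0 x).re) (hHx' : (deBruijnH 0 x').re < 0)
    (hq : q₀ ≤ (∫ y in Ioi (0 : ℝ), deBruijnH 0 ((x' : ℂ) + y) * (Real.exp (-(a * y)) : ℂ)).re) (hM0 : 0 ≤ M) (hM : ∀ r ∈ Icc x x', -M ≤ (deBruijnH 0 r).re)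
    (hmargin : (x' - x) * M < Real.exp (-(a * (x' - x))) * q₀) :
    ∃ z : ℂ, linearFactorH a z = 0 ∧ z.im ≠ 0 := by
  have h := not_linearRay_certificate ha hx hxx' hHx hHx' hq hM0 hM hmargin
  simp only [HasOnlyRealZeros, not_forall, exists_prop] at h
  obtain ⟨z, hz, hzim⟩ := h
  exact ⟨z, hz, hzim⟩

/-- **Scale-free form** (the shape a K₀-free interval engine can deliver: at height `x ~ 1.4·10⁴`,
`|H_0| ~ e^{−5500}`, so only statements homogeneous in an unevaluated common scale `κ > 0` are
certifiable): `κ q̂ ≤ Q_a(x')`, `−κ M̂ ≤ Re H_0` on `[x, x']`, and the RATIONAL margin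
`(x' − x)·M̂ < e^{−a(x'−x)}·q̂`. -/
theorem not_linearRay_certificate_scaled {a x x' κ q M : ℝ} (ha : 0 < a) (hx : 0 ≤ x)
    (hxx' : x ≤ x') (hκ : 0 < κ)
    (hHx : 0 < (deBruijnH 0 x).re) (hHx' : (deBruijnH 0 x').re < 0)
    (hq : κ * q ≤ (∫ y in Ioi (0 : ℝ), deBruijnH 0 ((x' : ℂ) + y) * (Real.exp (-(a * y)) : ℂ)).re) (hM0 : 0 ≤ M) (hM : ∀ r ∈ Icc x x', -(κ * M) ≤ (deBruijnH 0 r).re)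
    (hmargin : (x' - x) * M < Real.exp (-(a * (x' - x))) * q) : ¬ HasOnlyRealZeros (linearFactorH a) := by
  refine not_linearRay_certificate (q₀ := κ * q) (M := κ * M) ha hx hxx' hHx hHx' hq
    (mul_nonneg hκ.le hM0) hM ?_
  have h := mul_lt_mul_of_pos_left hmargin hκ
  nlinarith [h]


end Summit.RiemannHypothesis.RiemannHypothesis.Theorems.Splittings.LinearRayTwoPoint

end
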